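import Summits.BirchSwinnertonDyer.BirchSwinnertonDyer.Theorems.GenusKolyvaginAtTwoPowDvdShaCardAtTwoRTTwinShaLaddersOfExactSwap
import HarnessLib

/-!
# Route `GenusKolyvaginAtTwo`, LINE 18 (L_T `PowDvdShaCardAtTwoRT`, stmt-BirchSwinnertonDyer-23242), stub KS / stub L — the BOTTOM-RUNG socket
# in class currency: LEAD's all-deep 2-primitive product (level-2 order `4`) IS the `hbot` of the KS assembly (level-`L` order `2^L`)

Seat `bsd-line-gk2-p2` g19 (PROVER seat 2/3, cell `bsd-f1-sign2`), `--supports stmt-BirchSwinnertonDyer-23242` (helper; closes nothing).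
THEOREMS ONLY (no definition, no named fact, no `sorry`); BSD is not proved by any of this; neither is stub KS nor stub L.

WHAT (gk2-p5 g24's flag on `hbot`, STATUS 15:08Z; memo `Cruxes/PowDvdShaCardAtTwoRT/Lines/plus-descent-drops-guard-gk2p2.md` §5).  The KS
assembly (`twinShaLadders_of_exactSwap`, `…RTTwinShaLaddersOfExactSwap`) asks its bottom rung as «a square-free level of the margin class
(Zhang–Kolyvagin, `L + k ≤ index`, `FrobEqFrobInfty W K (2^(L+k))`) carrying a datum `d` with `addOrderOf c_L(d) = 2^L`».  LEAD g17's closure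
`RelaxedCount.exists_deep_primitive_of_gross_witness` (`…RTBottomRungClosure`, p722508), RUN AT THE LEVEL PARAMETER `L + k`, outputs «a
square-free `n` all of whose primes are Zhang–Kolyvagin of index `≥ L + k` with `FrobEqFrobInfty W K (2^(L+k))`, and a datum `e` with
`addOrderOf c₂(e) = 4`» (2-primitivity read at level `2`).  The two currencies agree: `addOrderOf c₂(e) = 4 ⟹ 2 ∤ P_e(n) ⟹ addOrderOf c_L(e) = 2^L`
(single-datum order formula `addOrderOf_kolyvaginClass_two_eq_pow_sub_single` with `k = 0`, and `pow_zsmul_kolyvaginClass_two_eq_zero_of_dvd`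
at level `2` for the contrapositive).
* `addOrderOf_kolyvaginClass_two_eq_pow_of_levelTwo_eq_four` — the order transfer;
* `hbot_of_deep_primitive_levelTwo` — the `hbot` socket from LEAD's closure conclusion shape;
* `twinShaLadders_of_exactSwap_of_deepPrimitive` — stub L's conclusion from `hswap` (LEAD's `exactSwap_core` shape) and LEAD's closure
  output at level parameter `L + k` (so ONE Lean `exact` per socket remains for the skeleton).
Namespace `…Theorems.GenusExact.PlusDescent`.  Closes nothing.  BSD is NOT proved by any of this.

References: [McCallumLMS1991] §4 Cor. 4.5, Lemma 4.6, §5 Prop. 5.2; [GrossLMS1991] §4 (4.1); [Kolyvagin1991MathAnn] Thm. 2.2.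
-/

set_option autoImplicit false
-- the Theorems namespace of this sub repeats the summit name by design (D-0017 nested layout)
set_option linter.dupNamespace false

noncomputable section

open scoped Classical

namespace Summit.BirchSwinnertonDyer.BirchSwinnertonDyer.Theorems.GenusExact.PlusDescent

open WeierstrassCurve NumberField IsDedekindDomain Field Literature.NumberTheory.EllipticCurves
  Literature.NumberTheory.GaloisRepresentations Literature.NumberTheory.EllipticCurves.ModularForms AddSubgroup
open Summit.BirchSwinnertonDyer.BirchSwinnertonDyer.Theses.GenusKolyvaginAtTwo (KolyvaginRelationAtTwo)

variable {K : Type} [Field K] [NumberField K]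

/-- **Order transfer from level `2` to level `L`**: a datum at a square-free product of Zhang–Kolyvagin primes of index `≥ L` (`L ≥ 2`) whose
level-`2` class has order `4` (i.e. `2 ∤ P(n)`) has level-`L` class of full order `2^L`. [cite: McCallumLMS1991, §4 Cor. 4.5, Lemma 4.6]
[cite: GrossLMS1991, §4 (4.1)] -/
theorem addOrderOf_kolyvaginClass_two_eq_pow_of_levelTwo_eq_four (W : WeierstrassCurve ℚ) [W.IsElliptic] [W.IsGloballyMinimal]
    [NeZero (W.conductorNorm ℤ)] (hIQ : IsImaginaryQuadratic K) (hodd : Odd (NumberField.discr K)) (h3 : NumberField.discr K ≠ -3)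
    (hHe : SatisfiesHeegnerHypothesis (W.conductorNorm ℤ) K) (hsurj1 : W.HasSurjectiveModNGaloisRep ((2 : ℤ) ^ 1))
    (Dt : ModularParametrizationData W (W.conductorNorm ℤ)) (β : ℤ) (ι : K →+* ℂ) {L : ℕ} (hL2 : 2 ≤ L)
    {n : ℕ} (hn : Squarefree n)
    (hnK : ∀ q ∈ n.primeFactors, Zhang2014.IsKolyvaginPrime (W.conductorNorm ℤ) W K 2 q ∧ L ≤ Zhang2014.kolyvaginIndex W 2 q)
    (e : KolyvaginHeegnerData Dt β ι n) (he : addOrderOf (e.kolyvaginClass Nat.prime_two 2) = 2 ^ 2) :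
    addOrderOf (e.kolyvaginClass Nat.prime_two L) = 2 ^ L := by
  have hnK2 : ∀ q ∈ n.primeFactors, Zhang2014.IsKolyvaginPrime (W.conductorNorm ℤ) W K 2 q ∧ 2 ≤ Zhang2014.kolyvaginIndex W 2 q :=
    fun q hq ↦ ⟨(hnK q hq).1, hL2.trans (hnK q hq).2⟩
  -- `2 ∤ P(n)`: else the level-2 class would be killed by `2`
  have hnot : ¬ ∃ B : (W.baseChange (ringClassField K ι n)).toAffine.Point, ((2 ^ (0 + 1) : ℕ) : ℤ) • B = e.derivedPoint := by
    intro hB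
    have h0 : ((2 ^ 1 : ℕ) : ℤ) • e.kolyvaginClass Nat.prime_two 2 = 0 :=
      pow_zsmul_kolyvaginClass_two_eq_zero_of_dvd hIQ hodd h3 hHe hsurj1 hn hnK2 e (j := 1) (by norm_num)
        (by simpa using hB)
    have hdvd : addOrderOf (e.kolyvaginClass Nat.prime_two 2) ∣ 2 ^ 1 := by
      rw [addOrderOf_dvd_iff_nsmul_eq_zero, ← natCast_zsmul]
      exact h0
    rw [he] at hdvd
    exact absurd (Nat.le_of_dvd (by norm_num) hdvd) (by norm_num)
  have h := addOrderOf_kolyvaginClass_two_eq_pow_sub_single hIQ hodd h3 hHe hsurj1 hn hnK e (k := 0) (Nat.zero_le L)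
    ⟨e.derivedPoint, by simp⟩ hnot
  simpa using h

/-- **The `hbot` socket of the KS assembly from LEAD's all-deep 2-primitive product** (the conclusion shape of
`RelaxedCount.exists_deep_primitive_of_gross_witness` run at level parameter `L + k`). [cite: McCallumLMS1991, §5 Prop. 5.2]
[cite: Kolyvagin1991MathAnn, Thm. 2.2] -/
theorem hbot_of_deep_primitive_levelTwo (W : WeierstrassCurve ℚ) [W.IsElliptic] [W.IsGloballyMinimal] [NeZero (W.conductorNorm ℤ)]
    (hIQ : IsImaginaryQuadratic K) (hodd : Odd (NumberField.discr K)) (h3 : NumberField.discr K ≠ -3)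
    (hHe : SatisfiesHeegnerHypothesis (W.conductorNorm ℤ) K) (hsurj1 : W.HasSurjectiveModNGaloisRep ((2 : ℤ) ^ 1))
    (Dt : ModularParametrizationData W (W.conductorNorm ℤ)) (β : ℤ) (ι : K →+* ℂ) {L : ℕ} (hL2 : 2 ≤ L) (k : ℕ)
    (hdeep : ∃ (n : ℕ) (e : KolyvaginHeegnerData Dt β ι n), Squarefree n ∧
      (∀ q ∈ n.primeFactors, Zhang2014.IsKolyvaginPrime (W.conductorNorm ℤ) W K 2 q ∧ L + k ≤ Zhang2014.kolyvaginIndex W 2 q ∧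
        FrobEqFrobInfty W K (2 ^ (L + k)) q) ∧
      addOrderOf (e.kolyvaginClass Nat.prime_two 2) = 2 ^ 2) :
    ∃ (n : ℕ) (d : KolyvaginHeegnerData Dt β ι n), Squarefree n ∧
      (∀ q ∈ n.primeFactors, (Zhang2014.IsKolyvaginPrime (W.conductorNorm ℤ) W K 2 q ∧ L ≤ Zhang2014.kolyvaginIndex W 2 q) ∧
        (L + k ≤ Zhang2014.kolyvaginIndex W 2 q ∧ FrobEqFrobInfty W K (2 ^ (L + k)) q)) ∧
      addOrderOf (d.kolyvaginClass Nat.prime_two L) = 2 ^ L := by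
  obtain ⟨n, e, hn, hnK, he⟩ := hdeep
  have hnKL : ∀ q ∈ n.primeFactors, Zhang2014.IsKolyvaginPrime (W.conductorNorm ℤ) W K 2 q ∧ L ≤ Zhang2014.kolyvaginIndex W 2 q :=
    fun q hq ↦ ⟨(hnK q hq).1, le_trans (Nat.le_add_right L k) (hnK q hq).2.1⟩
  exact ⟨n, e, hn, fun q hq ↦ ⟨hnKL q hq, (hnK q hq).2.1, (hnK q hq).2.2⟩,
    addOrderOf_kolyvaginClass_two_eq_pow_of_levelTwo_eq_four W hIQ hodd h3 hHe hsurj1 Dt β ι hL2 hn hnKL e he⟩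

/-- **STUB L's CONCLUSION FROM THE EXACT SWAP AND LEAD's ALL-DEEP PRIMITIVE PRODUCT** — `twinShaLadders_of_exactSwap` with `hbot` replaced by
the conclusion shape of `RelaxedCount.exists_deep_primitive_of_gross_witness` at level parameter `L + k` (`L ≥ max (M₀ + 1) 2`).
[cite: McCallumLMS1991, §5 Prop. 5.2, Thm. 5.4] [cite: Kolyvagin1991MathAnn, Thm. 2.1–2.2] [cite: GrossLMS1991, Thm. 1.3, §4 (4.1)] -/
theorem twinShaLadders_of_exactSwap_of_deepPrimitive (hP : PubInputsAtTwo) (hQ2 : KolyvaginRelationAtTwo)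
    (W : WeierstrassCurve ℚ) [W.IsElliptic] [W.IsGloballyMinimal] [NeZero (W.conductorNorm ℤ)] (hcm : ¬ W.HasCM) (hΔ : W.Δ < 0)
    (hT : Odd W.tamagawaProduct) (K : Type) [Field K] [NumberField K] (hIQ : IsImaginaryQuadratic K)
    (hodd : Odd (NumberField.discr K)) (h3 : NumberField.discr K ≠ -3) (hHe : SatisfiesHeegnerHypothesis (W.conductorNorm ℤ) K)
    (hns : ¬ IsSquare ((NumberField.discr K : ℚ) * -|W.Δ|))
    (hρ : ∀ n : ℕ, 0 < n → W.HasSurjectiveModNGaloisRep ((2 : ℤ) ^ n))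
    (Dt : ModularParametrizationData W (W.conductorNorm ℤ)) (β : ℤ) (ι : K →+* ℂ) (d₁ : KolyvaginHeegnerData Dt β ι 1)
    (hy : ¬ IsOfFinAddOrder d₁.derivedPoint) (M₀ : ℕ)
    (hM₀ : ∃ Q : (W.baseChange (ringClassField K ι 1)).toAffine.Point, ((2 ^ M₀ : ℕ) : ℤ) • Q = d₁.derivedPoint)
    (hndiv : ¬ ∃ Q : (W.baseChange (ringClassField K ι 1)).toAffine.Point, ((2 ^ (M₀ + 1) : ℕ) : ℤ) • Q = d₁.derivedPoint)
    (Wd : WeierstrassCurve ℚ) [Wd.IsElliptic] (hTw : ∃ C : VariableChange ℚ, C • W.quadraticTwist (NumberField.discr K : ℚ) = Wd)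
    {L : ℕ} (hML : M₀ + 1 ≤ L) (hL2 : 2 ≤ L) (k : ℕ)
    (hNPh : ∀ z : galH1Torsion (W.baseChange K) ((2 ^ (L + k) : ℕ) : ℤ),
      (∀ ρ' ∈ torsionFixing (W.baseChange K) ((2 ^ (L + k) : ℕ) : ℤ), h1Eval (W.baseChange K) ((2 ^ (L + k) : ℕ) : ℤ) z ρ' = 0) →
      (∀ w : HeightOneSpectrum (𝓞 K), z ∈ selmerLocalKer (W.baseChange K) (w.adicCompletion K) ((2 ^ (L + k) : ℕ) : ℤ)) → z = 0)
    (hdeep : ∃ (n : ℕ) (e : KolyvaginHeegnerData Dt β ι n), Squarefree n ∧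
      (∀ q ∈ n.primeFactors, Zhang2014.IsKolyvaginPrime (W.conductorNorm ℤ) W K 2 q ∧ L + k ≤ Zhang2014.kolyvaginIndex W 2 q ∧
        FrobEqFrobInfty W K (2 ^ (L + k)) q) ∧
      addOrderOf (e.kolyvaginClass Nat.prime_two 2) = 2 ^ 2)
    (hswap : ∀ τ : K ≃ₐ[ℚ] K, τ ≠ 1 → ∀ (r m : ℕ), 1 ≤ r → m < M₀ →
      (∀ (n : ℕ) (e : KolyvaginHeegnerData Dt β ι n), Squarefree n → n.primeFactors.card = r →
        (∀ q ∈ n.primeFactors, (Zhang2014.IsKolyvaginPrime (W.conductorNorm ℤ) W K 2 q ∧ L ≤ Zhang2014.kolyvaginIndex W 2 q) ∧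
          (L + k ≤ Zhang2014.kolyvaginIndex W 2 q ∧ FrobEqFrobInfty W K (2 ^ (L + k)) q)) →
        ((2 ^ (L - m) : ℕ) : ℤ) • e.kolyvaginClass Nat.prime_two L = 0) →
      ∀ (n : ℕ) (d : KolyvaginHeegnerData Dt β ι n), Squarefree n → n.primeFactors.card = r →
      (∀ q ∈ n.primeFactors, (Zhang2014.IsKolyvaginPrime (W.conductorNorm ℤ) W K 2 q ∧ L ≤ Zhang2014.kolyvaginIndex W 2 q) ∧
        (L + k ≤ Zhang2014.kolyvaginIndex W 2 q ∧ FrobEqFrobInfty W K (2 ^ (L + k)) q)) →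
      addOrderOf (d.kolyvaginClass Nat.prime_two L) = 2 ^ (L - m) →
      ∀ ℓ₀ ∈ n.primeFactors, ∀ X : Finset ℕ, ∃ ℓ' : ℕ, ℓ' ∉ X ∧ ℓ' ∉ n.primeFactors ∧
        Zhang2014.IsKolyvaginPrime (W.conductorNorm ℤ) W K 2 ℓ' ∧ L + k ≤ Zhang2014.kolyvaginIndex W 2 ℓ' ∧
        FrobEqFrobInfty W K (2 ^ (L + k)) ℓ' ∧
        (∀ v : HeightOneSpectrum (𝓞 K), ((ℓ' : ℕ) : 𝓞 K) ∈ v.asIdeal →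
          ((2 ^ (L - m - 1) : ℕ) : ℤ) • d.kolyvaginClass Nat.prime_two L ∉
            (W.baseChange K).torsionLocalKer (v.adicCompletion K) ((2 ^ L : ℕ) : ℤ)) ∧
        ∃ d' : KolyvaginHeegnerData Dt β ι (n / ℓ₀ * ℓ'),
          ((2 ^ (L - m - 1) : ℕ) : ℤ) • d'.kolyvaginClass Nat.prime_two L ≠ 0) :
    ∃ (T : ℕ) (M : ℕ → ℕ), (∀ j, M (j + 1) ≤ M j) ∧ M 0 = M₀ ∧ M (2 * T) = 0 ∧
      (∀ m < T, ∃ x : Fin (2 * m + 2) → W.galH1, (∀ i, resBaseChange W K (x i) ∈ (W.baseChange K).sha) ∧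
        (∀ i, addOrderOf (x i) = 2 ^ (M (2 * m) - M (2 * m + 1))) ∧
        ∀ c : Fin (2 * m + 2) → ℤ, ∑ i, c i • x i = 0 → ∀ i, ((2 ^ (M (2 * m) - M (2 * m + 1)) : ℕ) : ℤ) ∣ c i) ∧
      (∀ m < T, ∃ x : Fin (2 * m + 2) → Wd.galH1, (∀ i, resBaseChange Wd K (x i) ∈ (Wd.baseChange K).sha) ∧
        (∀ i, addOrderOf (x i) = 2 ^ (M (2 * m + 1) - M (2 * m + 2))) ∧
        ∀ c : Fin (2 * m + 2) → ℤ, ∑ i, c i • x i = 0 → ∀ i, ((2 ^ (M (2 * m + 1) - M (2 * m + 2)) : ℕ) : ℤ) ∣ c i) :=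
  twinShaLadders_of_exactSwap hP hQ2 W hcm hΔ hT K hIQ hodd h3 hHe hns hρ Dt β ι d₁ hy M₀ hM₀ hndiv Wd hTw hML k hNPh
    (hbot_of_deep_primitive_levelTwo W hIQ hodd h3 hHe (by exact_mod_cast hρ 1 one_pos) Dt β ι hL2 k hdeep) hswap

end Summit.BirchSwinnertonDyer.BirchSwinnertonDyer.Theorems.GenusExact.PlusDescent

end
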